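import Literature.NumberTheory.Automorphic.AHTW2026LocalGlobalAtP
import Literature.NumberTheory.Automorphic.ClozelPurityProofs
import HarnessLib

/-!
# A'Campo–Hevesi–Thorne–Whitmore 2026, Thm. 1.2.1: the EXACT labelled Hodge–Tate weights of
# `r_{π,ι}` for regular algebraic cuspidal `π` on `GL_n` over a CM field

Topic `NumberTheory/Automorphic`; sibling of `AHTW2026LocalGlobalAtP`, whose named fact
`AHTW2026.deRham_hodgeTateRegular 𝓓` keeps only the `Nodup` shadow of the Hodge–Tate clause of the
printed theorem because "the exact values `λ_{ιτ,j} + n − j` would need the weight `λ` of `π` as a typed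
function of the embeddings `K → ℂ`, which the tree's `IsRegularAlgebraic` does not expose" (its module
docstring).  The infinity type IS exposed by the accepted `InfinityType K n` /
`AutomorphicRepData.HasInfinityType` / `InfinityType.IsRegularAlgebraic` (files `InfinityType`,
`ClozelPurity*`: the `a`-multisets of `T` are the Harish-Chandra parameter of `π_∞`, embedding by
embedding — the vocabulary of the PROVED purity lemma `CuspidalAutomorphicRepData.purity`), so the exact
clause can be vendored: ONE NAMED FACT (D-0014), `AHTW2026.labelledHodgeTateWeights_eq 𝓓`, same binders
and house style as the sibling (the `p`-adic Hodge data `𝓓` a PARAMETER, instantiated by consumers at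
Fontaine's pinned `fontainePstAdicCompletion`; `r` any continuous semisimple representation with HLTT's
characterising property; `τ : K_v → ℚ̄_ℓ` continuous).  Wanted by crux `stmt-Langlands-17000`
(`NonParallelVoid.TwistedInductionParallel`, line `symmetrise-pd-split`, stub 4
`stub_parallelOfAutomorphicTwist`, whose wave-1 proof consumes exactly this clause).

L. A'Campo, B. Hevesi, J. A. Thorne, D. Whitmore, *Local-global compatibility of automorphic Galois
representations over CM fields at `p`*, arXiv:2607.11763 (2026), **Theorem 1.2.1** (p. 5 of the held
text), as printed (see the sibling for the full quotation): "… for any place `v | p` of `F`, the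
representation `r_{π,ι}|_{G_{F_v}}` is de Rham of Hodge–Tate weights
`HT_τ(r_{π,ι}) = {λ_{ιτ,1} + (n−1), λ_{ιτ,2} + (n−2), …, λ_{ιτ,n}}` …", with (p. 4) "the weight
`λ = (λ_τ)_τ ∈ (ℤⁿ)^{Hom(F,ℂ)}` … defined by the requirement that `π_∞` have the same infinitesimal
character as `V_λ^∨`".

## Rendering (WEAKER than the source, never stronger)

Dictionary `λ ↔ T`: an infinity type `T` of `π` has `a`-multiset `{j − (n+1)/2 − λ_{σ,j} : j}` at
`σ : K → ℂ` (infinitesimal character of `V_λ^∨`), so the printed weights `{λ_{ιτ,j} + n − j}` are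
`{(n−1)/2 − a : a ∈ a-multiset of T at ι ∘ τ}`; a label is the pair `(v, τ_v)`, `τ_v : K_v → ℚ̄_ℓ`
continuous, with global embedding `τ = τ_v ∘ (K → K_v)` (module docstring of
`LabelledHodgeTateWeights`); both sides are cast into `ℂ` (the weights are integers, the `a`'s
half-integers in general).  Sanity checks: (`n = 2`) a weight-`k` eigenform has
`a ∈ {(k−1)/2, (1−k)/2}` and `r_{ℓ,ι}(π_f) = ρ_f ⊗ ε^{(k−2)/2}` has `HT = {1 − k/2, k/2} = {1/2 − a}`
(convention `HT(ε) = −1` of the tree); (`n = 1`) the avatar of a type-`(a, b)` Hecke character has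
`HT = −a`.  The de Rham clause and the `WD^{ss}` clause are in the sibling / not vendored.

## References

* [AHTW2026] L. A'Campo, B. Hevesi, J. A. Thorne, D. Whitmore, arXiv:2607.11763, Thm. 1.2.1 (p. 5),
  §1.1 p. 4 (the weight `λ`).
* [HarrisLanTaylorThorneRMS2016] M. Harris, K.-W. Lan, R. Taylor, J. Thorne, Res. Math. Sci. 3:37
  (2016), Thm. A (`r_{ℓ,ι}(π)`).
* [Clozel1990] L. Clozel, *Motifs et formes automorphes*, Perspect. Math. 10 (1990), §1.2, §3 (regular
  algebraic, infinity types).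
-/

noncomputable section

open scoped NumberField
open NumberField IsDedekindDomain Filter
open Literature.NumberTheory.GaloisRepresentations

namespace Literature.NumberTheory.Automorphic

namespace AHTW2026

/-- **A'Campo–Hevesi–Thorne–Whitmore 2026, Thm. 1.2.1 — the EXACT labelled Hodge–Tate weights**
(the clause of which the tree's `AHTW2026.deRham_hodgeTateRegular` keeps only the `Nodup` shadow),
NAMED FACT relative to `p`-adic Hodge data `𝓓` (a parameter, exactly as there).  Printed (arXiv:2607.11763,
Thm. 1.2.1, p. 5): for `F` CM, `n ≥ 1`, `ι : ℚ̄_p ≅ ℂ`, `π` cuspidal regular algebraic on `GL_n(𝔸_F)` of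
weight `λ`, and every `v ∣ p`, "`r_{π,ι}|_{G_{F_v}}` is de Rham of Hodge–Tate weights
`HT_τ(r_{π,ι}) = {λ_{ιτ,1} + (n−1), λ_{ιτ,2} + (n−2), …, λ_{ιτ,n}}`", where (p. 4) "the weight
`λ = (λ_τ)_τ ∈ (ℤⁿ)^{Hom(F,ℂ)}` is defined by the requirement that `π_∞` have the same infinitesimal
character as `V_λ^∨`".  Dictionary with the tree: an infinity type `T` of `π` (`HasInfinityType`: the
`a`-multisets of `T` ARE the Harish-Chandra parameter of `π_∞`, embedding by embedding) has
`a`-multiset `{j − (n+1)/2 − λ_{σ,j} : j}` at `σ` (infinitesimal character of `V_λ^∨`), so the printed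
weights `{λ_{ιτ,j} + n − j}` are `{(n−1)/2 − a : a ∈ a-multiset of T at ι ∘ τ}`; a label is a pair
`(v, τ_v)` with `τ_v : F_v → ℚ̄_p` continuous, its global embedding `τ = τ_v ∘ (F → F_v)` (module
docstring of `LabelledHodgeTateWeights`); `r_{π,ι}` is any continuous semisimple `r` with HLTT's
characterising property (`HarrisLanTaylorThorne2016.IsCompatible`, all conjugate to `r_{π,ι}` by
`theoremA_uniqueness_holds`), as in `deRham_hodgeTateRegular`.  Sanity check (`n = 2`, `F = ℚ`-shape):
a weight-`k` eigenform has `a ∈ {(k−1)/2, (1−k)/2}` and `r_{ℓ,ι}(π_f) = ρ_f ⊗ ε^{(k−2)/2}` has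
`HT = {1 − k/2, k/2} = {1/2 − a}` (convention `HT(ε) = −1` of the tree). [cite: AHTW2026, Thm. 1.2.1] -/
def labelledHodgeTateWeights_eq
    (𝓓 : ∀ (K : Type) [Field K] [NumberField K] (p : ℕ) [Fact p.Prime]
      (v : HeightOneSpectrum (𝓞 K)), ((p : ℕ) : 𝓞 K) ∈ v.asIdeal →
        PstWeilDeligneData (v.adicCompletion K) p) : Prop :=
  ∀ (K : Type) [Field K] [NumberField K], IsCMField K →
    ∀ (n : ℕ), 1 ≤ n →
    ∀ (hcpt : isCompact_glFiniteIntegralLevel n K) (π : CuspidalAutomorphicRepData n K hcpt)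
      (T : InfinityType K n), π.1.HasInfinityType T → T.IsRegularAlgebraic →
    ∀ (ℓ : ℕ) [Fact ℓ.Prime] (ι : PadicAlgCl ℓ ≃+* ℂ) (r : FramedGaloisRep K (PadicAlgCl ℓ) n),
      r.toGaloisRep.IsSemisimple → HarrisLanTaylorThorne2016.IsCompatible π.1 ι r →
      ∀ (v : HeightOneSpectrum (𝓞 K)) (hv : ((ℓ : ℕ) : 𝓞 K) ∈ v.asIdeal)
        (τ : v.adicCompletion K →+* PadicAlgCl ℓ), Continuous τ →
        ((r.labelledHodgeTateWeightsAt v (𝓓 K ℓ v hv).algebra (𝓓 K ℓ v hv).𝔅 τ).map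
            fun h : ℤ => (h : ℂ)) =
          ((T (ι.toRingHom.comp (τ.comp (algebraMap K (v.adicCompletion K))))).map
            fun w : ArchWeight => ((n : ℂ) - 1) / 2 - w.a)


end AHTW2026

end Literature.NumberTheory.Automorphic

end
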